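import Summits.Ventures.HSemireg.ObstructionLocusCrossingExtMid
import Summits.Ventures.HSemireg.ObstructionLocusCrossingSplitting
import Summits.Ventures.HSemireg.ObstructionLocusPartialBranchTuples

/-!
# Venture HSemireg — (S5) OBSTRUCTION LOCUS away from secant type, XLIV: EXT-NOTE §6.B(c) IN EVERY DEGREE AT EVERY
# CROSSING GERM, KÜNNETH-FREE — `Ext^q_R(I_M, I_M) ≃ₗ[R] Π_{τ} R ⧸ J_τ` over the partial branch tuples `τ` on
# exactly `q` blocks, for EVERY block model, every `q`, every number of blocks, every `n`, ANY commutative ring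

HONEST FRAMING.  Part of the Lean side of the computation cell `pub-hsemireg` (track «S4-PUSH» (ii), seat
s4-prove-2).  Plain commutative / homological algebra in `R = MvPolynomial (Fin n) K`, every `n`, EVERY commutative
ring `K`, with Mathlib's derived `CategoryTheory.Abelian.Ext`.  Nothing here constructs a variety or a sheaf; nothing
here says that HC / HC_CM / HC_AV holds; no Literature fact is declared or used; no object is certified.

THE STATEMENT (EXT-NOTE §6.B(c), all degrees).  For a block model `M = M(S_1, …, S_r)` (file XVI; `I_M = ⋂_i I_{S_i}`)
and `q ≥ 0`, a PARTIAL BRANCH TUPLE ON `q` BLOCKS is a choice of `q` of the blocks and of one branch datum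
`(a_i, b_i)` (`a_i ∈ S_i`, `b_i ∈ S_i ∖ a_i`) in each chosen block (file XLIII's `PBT B q`), with ideal
`J_τ = Σ_{i chosen} (x_{b_i}, x_{a_i})`.  **`extEquiv B q : Ext^q_R(I_M, I_M) ≃ₗ[R] Π_{τ ∈ PBT(M, q)} R ⧸ J_τ`** —
«the stalk of `𝓔xt^q(I_Z, I_Z)` at a point through which `r` translates pass is the sum, over the `q`-element sets of
translates through the point and the choices of one component `B_i ⊂ W + t_i` of each, of the functions on
`⋂ B_i`, and nothing else» (the tensor-product ∕ Künneth shape `⊕_{|J| = q} ⊗_{i ∈ J} 𝓝′_i ⊗ ⊗_{i ∉ J} 𝒪`, as a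
theorem about Mathlib's derived `Ext`, with no Künneth formula, no grading, no localisation).  Special cases already
in the tree or keyed: `q = 0` (`Hom_R(I_M, I_M) = R`), `q = 1` (file XXIX, `𝓔xt¹ = 𝓝′`), `q = r` (file XXXVII),
`(q, r) = (2, 2)` (file XXXV), `(q, r) = (2, 3)` (file XLI, there only as an extension); `q > r`: no partial tuple,
`Ext = 0` (file XXX).  New: every middle degree at every `r`-fold point, `r ≥ 4` (`n ≥ 8`) included, and the
SPLITTING of file XLI's extension.

THE PROOF, by induction on the number of blocks, ALL DEGREES AT ONCE, peeling one block `S = S_{i₀}` (`V := I_{M′}`,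
dévissage `0 → V^{S∖a₀} →Φ V^S → I_M → 0` of files XXVII/XXVIII; `E′_q := Ext^q(V, V) = Π_{τ′ ∈ PBT(M′, q)} R ⧸ J_{τ′}`
by INDUCTION, in every degree):
(1) `Φ_*` is injective on `Ext^q(V, V^{S∖a₀}) = E′_q{}^{S∖a₀}` in EVERY degree (every `x_a`, `a ∈ S`, is a
    non-zero-divisor on every `R ⧸ J_{τ′}`, files XXXIX/XLI), so `E_q := Ext^q(V, I_M) = E′_q{}^S ⧸ Φ E′_q{}^{S∖a₀}`
    (file XXXVIII's covariant cokernel under injectivity) — `eKEquiv`;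
(2) the contravariant sequence around `Ext^{k+1}(I_M, I_M)` gives the SUB-piece `range ∂ = E_k^{S∖a₀} ⧸ Φᵀ =
    Π_{τ′ ∈ PBT(M′,k)} Π_{t ∈ Br(S)} R ⧸ ((x_b, x_a) + J_{τ′})` (flatten, product, file XXXV's `yQuotEquiv`) —
    `subPieceEquiv` — and the QUOTIENT piece `ker(Φᵀ on E_{k+1}-vectors) = Π_{τ′ ∈ PBT(M′,k+1)} R ⧸ J_{τ′}` (file XL's
    core `kerTransposeEquiv` factor by factor) — `quotPieceEquiv`; in degree `0` only the kernel piece occurs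
    (`extZeroStepEquiv`, with `Ext⁰(X₃, N) = ker f^*`);
(3) THE SPLITTING (file XLII): a quotient piece `τ′` uses `k + 1` blocks of `M′`, a sub piece `(t, τ″)` only `k`, so
    some block used by `τ′` is unused by `τ″` and its two variables act freely on `R ⧸ ((x_b, x_a) + J_{τ″})`
    (file XLIII's `exists_free_pair`) — `extSuccStepEquiv`;
(4) re-index with file XLIII's `pbtQuotPiSuccEquiv` ∕ `pbtQuotPiZeroEquiv`.  Base: no blocks, `I_M = R`,
`Ext⁰ = R`, `Ext^{>0} = 0`.
References (dictionary only): EXT-NOTE.md §6.A, §6.B(c), §6.D.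
-/

open CategoryTheory CategoryTheory.Abelian MvPolynomial Finset
open scoped BigOperators

universe u

namespace Summit.Ventures.HSemireg.ObstructionLocus.BlockModel

variable {K : Type u} [CommRing K] {n : ℕ}

/-! ## Generic: the degree-`0` end of the contravariant long exact sequence -/

section DegZero

variable {A : Type u} [CommRing A] {S : ShortComplex (ModuleCat.{u} A)} (hS : S.ShortExact) (N : ModuleCat.{u} A)

include hS in
/-- `g^*` is injective on `Ext⁰(X₃, N)` (`g` is an epimorphism). -/
theorem extPrecompG_zero_injective : Function.Injective (extPrecompG (S := S) N 0) := by
  haveI := hS.epi_g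
  intro x y hxy
  exact Ext.precomp_mk₀_injective_of_epi N S.g hxy

/-- **`Ext⁰(X₃, N) ≃ₗ[A] ker(f^* : Ext⁰(X₂, N) → Ext⁰(X₁, N))`**, induced by `g^*`. -/
noncomputable def extZeroEquivKer :
    Ext.{u} S.X₃ N 0 ≃ₗ[A] ↥(LinearMap.ker (extPrecomp (S := S) N 0)) :=
  (LinearEquiv.ofInjective (extPrecompG (S := S) N 0) (extPrecompG_zero_injective hS N)).trans
    (LinearEquiv.ofEq _ _ (range_extPrecompG_eq_ker_extPrecomp hS N 0))

end DegZero

/-! ## The inductive step in every degree -/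

section Step

variable {ι : Type} [Fintype ι] [DecidableEq ι] (B : Blocks ι n) (i₀ : ι) {a₀ : Fin n} (ha₀ : a₀ ∈ B.S i₀)

/-- `I_M = I_S ∩ V` as an object of `ModuleCat R`. -/
noncomputable abbrev IMod : ModuleCat.{u} (MvPolynomial (Fin n) K) :=
  ModuleCat.of (MvPolynomial (Fin n) K) ↥(blockIdeal K (B.S i₀) ⊓ otherIdeal (K := K) B i₀)

/-- `Ext^q_R(I_M, I_M)` on `I_M = I_S ∩ V`. -/
noncomputable abbrev EI (q : ℕ) : Type u := Ext.{u} (IMod (K := K) B i₀) (IMod (K := K) B i₀) q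

/-- The pieces `R ⧸ J_{τ′}` over the partial tuples of the OTHER blocks of degree `q`. -/
noncomputable abbrev PQ (q : ℕ) (τ : PBT (B.restrict (· ≠ i₀)) q) : Type u :=
  MvPolynomial (Fin n) K ⧸ ptupleIdeal K (B.restrict (· ≠ i₀)) τ.1

/-- Every `x_a`, `a ∈ S_{i₀}`, acts injectively on `R ⧸ J_{τ′}`. -/
theorem X_smul_PQ_injective (q : ℕ) (τ : PBT (B.restrict (· ≠ i₀)) q) {a : Fin n} (ha : a ∈ B.S i₀) :
    Function.Injective fun m : PQ (K := K) B i₀ q τ => (X a : MvPolynomial (Fin n) K) • m :=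
  smul_injective_of_equiv
    (Submodule.quotEquivOfEq _ _ (ptupleIdeal_eq_varIdeal (K := K) (B.restrict (· ≠ i₀)) τ.1))
    (X a) (X_smul_quot_injective _ (notMem_pvars_restrict B i₀ τ.1 ha))

variable (e : ∀ q : ℕ, EPrimeK (K := K) B i₀ q ≃ₗ[MvPolynomial (Fin n) K]
  ((τ : PBT (B.restrict (· ≠ i₀)) q) → PQ (K := K) B i₀ q τ))

include e in
/-- Every `x_a`, `a ∈ S_{i₀}`, acts injectively on `E′_q = Ext^q_R(V, V)` (given the product description `e`). -/
theorem X_smul_EPrimeK_injective (q : ℕ) {a : Fin n} (ha : a ∈ B.S i₀) :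
    Function.Injective fun m : EPrimeK (K := K) B i₀ q => (X a : MvPolynomial (Fin n) K) • m :=
  smul_injective_of_equiv (e q) (X a)
    (X_smul_pi_injective _ (X a) fun τ => X_smul_PQ_injective (K := K) B i₀ q τ ha)

include e in
/-- **`Φ_*` is injective on `Ext^q(V, V^{S∖a₀})` in every degree** (`Φ` on `E′_q`-valued vectors). -/
theorem extPostcomp_injective (q : ℕ) :
    Function.Injective (extPostcomp (S := devissage (B.S i₀) (otherIdeal (K := K) B i₀) ha₀)
      (ModuleCat.of (MvPolynomial (Fin n) K) ↥(otherIdeal (K := K) B i₀)) q) := by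
  intro ζ ζ' h
  have h' := congrArg (extCoPiEquiv ↥(otherIdeal (K := K) B i₀) ↥(B.S i₀)
    (ModuleCat.of (MvPolynomial (Fin n) K) ↥(otherIdeal (K := K) B i₀)) q) h
  rw [extCoPiEquiv_extPostcomp B i₀ ha₀ q, extCoPiEquiv_extPostcomp B i₀ ha₀ q] at h'
  have hinj := scalarMatrix_hbMatrix_injective_of_smul_injective (K := K) (B.S i₀) a₀
    (M := EPrimeK (K := K) B i₀ q) (fun _ ha _ => X_smul_EPrimeK_injective (K := K) B i₀ e q ha)
  exact (extCoPiEquiv ↥(otherIdeal (K := K) B i₀) ↥((B.S i₀).erase a₀) _ q).injective (hinj h')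

/-- **Step (1) in every degree: `E_q = Ext^q(V, I_M) ≃ₗ[R] (Π_{τ′} R ⧸ J_{τ′})^S ⧸ range Φ`.** -/
noncomputable def eKEquiv (q : ℕ) :
    EK (K := K) B i₀ q ≃ₗ[MvPolynomial (Fin n) K]
      ((↥(B.S i₀) → (τ : PBT (B.restrict (· ≠ i₀)) q) → PQ (K := K) B i₀ q τ) ⧸
        LinearMap.range (scalarMatrix ((τ : PBT (B.restrict (· ≠ i₀)) q) → PQ (K := K) B i₀ q τ)
          (hbMatrix (K := K) (B.S i₀) a₀))) :=
  ((extCokernelEquivOfInjective' (devissage_shortExact_twoBlocks (K := K) B i₀ ha₀)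
      (ModuleCat.of (MvPolynomial (Fin n) K) ↥(otherIdeal (K := K) B i₀)) q
      (extPostcomp_injective (K := K) B i₀ ha₀ e (q + 1))).symm.trans
    (Submodule.Quotient.equiv _ _ _ (map_range_extPostcomp_eq_degree (K := K) B i₀ ha₀ q))).trans
    (quotRangeCongr (hbMatrix (K := K) (B.S i₀) a₀) (e q))

/-! ### The sub-piece `range ∂` in degree `k + 1` -/

/-- The canonical submodule `range ∂ ⊆ Ext^{k+1}(I_M, I_M)`, `∂ : Ext^k(V^{S∖a₀}, I_M) → Ext^{k+1}(I_M, I_M)` the connecting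
map of the dévissage. -/
noncomputable def subPiece (k : ℕ) : Submodule (MvPolynomial (Fin n) K) (EI (K := K) B i₀ (k + 1)) :=
  LinearMap.range (extConnecting (devissage_shortExact_twoBlocks (K := K) B i₀ ha₀) (IMod (K := K) B i₀) k)

/-- **The sub-piece: `range ∂ ≃ₗ[R] Π_{τ′ ∈ PBT(M′, k)} Π_{t ∈ Br(S)} R ⧸ ((x_{t.b}, x_{t.a}) + J_{τ′})`.** -/
noncomputable def subPieceEquiv (k : ℕ) :
    ↥(subPiece (K := K) B i₀ ha₀ k) ≃ₗ[MvPolynomial (Fin n) K]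
      ((τ' : PBT (B.restrict (· ≠ i₀)) k) → (t : Br B i₀) →
        MvPolynomial (Fin n) K ⧸
          (Ideal.span {(X t.1.2.2 : MvPolynomial (Fin n) K), X t.1.2.1} ⊔
            ptupleIdeal K (B.restrict (· ≠ i₀)) τ'.1)) :=
  ((rangeExtConnectingEquiv (devissage_shortExact_twoBlocks (K := K) B i₀ ha₀) (IMod (K := K) B i₀) k).symm.trans
    ((Submodule.Quotient.equiv _ _ _ (map_range_extPrecomp_eq_degree (K := K) B i₀ ha₀ k)).trans
      ((quotRangeCongr (fun b a => hbMatrix (K := K) (B.S i₀) a₀ a b) (eKEquiv (K := K) B i₀ ha₀ e k)).trans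
        (flattenEquiv _ _).symm))).trans
    ((quotRelYPiEquiv _ _ (fun τ' : PBT (B.restrict (· ≠ i₀)) k => PQ (K := K) B i₀ k τ')).trans
      (LinearEquiv.piCongrRight fun τ' =>
        yQuotEquiv (K := K) B i₀ ha₀ (ptupleIdeal K (B.restrict (· ≠ i₀)) τ'.1)))

/-! ### The kernel piece in every degree -/

/-- The kernel piece, factor by factor: `ker(Φᵀ on ((R ⧸ J_{τ′})^S ⧸ Φ)-vectors) ≃ₗ[R] R ⧸ J_{τ′}` (file XL's core). -/
noncomputable def kerFactorEquivPBT (q : ℕ) (τ : PBT (B.restrict (· ≠ i₀)) q) :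
    ↥(LinearMap.ker (scalarMatrix
        ((↥(B.S i₀) → PQ (K := K) B i₀ q τ) ⧸
          LinearMap.range (scalarMatrix (PQ (K := K) B i₀ q τ) (hbMatrix (K := K) (B.S i₀) a₀)))
        (fun b a => hbMatrix (K := K) (B.S i₀) a₀ a b)))
      ≃ₗ[MvPolynomial (Fin n) K] PQ (K := K) B i₀ q τ :=
  let eq : PQ (K := K) B i₀ q τ ≃ₗ[MvPolynomial (Fin n) K]
      MvPolynomial (Fin n) K ⧸ varIdeal K (pvars (B.restrict (· ≠ i₀)) τ.1) :=
    Submodule.quotEquivOfEq _ _ (ptupleIdeal_eq_varIdeal (K := K) (B.restrict (· ≠ i₀)) τ.1)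
  ((kerScalarMatrixCongr (fun b a => hbMatrix (K := K) (B.S i₀) a₀ a b)
      (quotRangeCongr (hbMatrix (K := K) (B.S i₀) a₀) eq)).trans
    (kerTransposeEquiv (K := K) (B.S i₀) (pvars (B.restrict (· ≠ i₀)) τ.1) ha₀
      (fun _ ha => notMem_pvars_restrict B i₀ τ.1 ha)).symm).trans eq.symm

/-- **The kernel piece: `ker(Φᵀ on E_q-vectors) ≃ₗ[R] Π_{τ′ ∈ PBT(M′, q)} R ⧸ J_{τ′}`.** -/
noncomputable def kerPieceEquiv (q : ℕ) :
    ↥(LinearMap.ker (scalarMatrix (EK (K := K) B i₀ q) (fun b a => hbMatrix (K := K) (B.S i₀) a₀ a b)))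
      ≃ₗ[MvPolynomial (Fin n) K] ((τ : PBT (B.restrict (· ≠ i₀)) q) → PQ (K := K) B i₀ q τ) :=
  ((kerScalarMatrixCongr (fun b a => hbMatrix (K := K) (B.S i₀) a₀ a b) (eKEquiv (K := K) B i₀ ha₀ e q)).trans
    (kerScalarMatrixQuotPiEquiv (PQ (K := K) B i₀ q) (hbMatrix (K := K) (B.S i₀) a₀)
      (fun b a => hbMatrix (K := K) (B.S i₀) a₀ a b))).trans
    (LinearEquiv.piCongrRight fun τ => kerFactorEquivPBT (K := K) B i₀ ha₀ q τ)

/-- **The quotient piece in degree `k + 1`: `Ext^{k+1}(I_M, I_M) ⧸ range ∂ ≃ₗ[R] Π_{τ′ ∈ PBT(M′, k+1)} R ⧸ J_{τ′}`.** -/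
noncomputable def quotPieceEquiv (k : ℕ) :
    (EI (K := K) B i₀ (k + 1) ⧸ subPiece (K := K) B i₀ ha₀ k) ≃ₗ[MvPolynomial (Fin n) K]
      ((τ : PBT (B.restrict (· ≠ i₀)) (k + 1)) → PQ (K := K) B i₀ (k + 1) τ) :=
  ((quotRangeExtConnectingEquiv (devissage_shortExact_twoBlocks (K := K) B i₀ ha₀) (IMod (K := K) B i₀) k).trans
    (kerEquivOfSquare _ _
      (extPiEquiv ↥(otherIdeal (K := K) B i₀) ↥(B.S i₀) (IMod (K := K) B i₀) (k + 1))
      (extPiEquiv ↥(otherIdeal (K := K) B i₀) ↥((B.S i₀).erase a₀) (IMod (K := K) B i₀) (k + 1))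
      (extPiEquiv_extPrecomp (K := K) B i₀ ha₀ (k + 1)))).trans
    (kerPieceEquiv (K := K) B i₀ ha₀ e (k + 1))

/-- **Degree `0`: `Ext⁰(I_M, I_M) ≃ₗ[R] Π_{τ′ ∈ PBT(M′, 0)} R ⧸ J_{τ′}`** (`= R`; only the kernel piece occurs). -/
noncomputable def extZeroStepEquiv :
    EI (K := K) B i₀ 0 ≃ₗ[MvPolynomial (Fin n) K] ((τ : PBT (B.restrict (· ≠ i₀)) 0) → PQ (K := K) B i₀ 0 τ) :=
  ((extZeroEquivKer (devissage_shortExact_twoBlocks (K := K) B i₀ ha₀) (IMod (K := K) B i₀)).trans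
    (kerEquivOfSquare _ _
      (extPiEquiv ↥(otherIdeal (K := K) B i₀) ↥(B.S i₀) (IMod (K := K) B i₀) 0)
      (extPiEquiv ↥(otherIdeal (K := K) B i₀) ↥((B.S i₀).erase a₀) (IMod (K := K) B i₀) 0)
      (extPiEquiv_extPrecomp (K := K) B i₀ ha₀ 0))).trans
    (kerPieceEquiv (K := K) B i₀ ha₀ e 0)

/-! ### The splitting in degree `k + 1` -/

/-- The quotient map `Ext^{k+1}(I_M, I_M) ↠ Π_{τ′ ∈ PBT(M′, k+1)} R ⧸ varIdeal(vars τ′)`. -/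
noncomputable def quotPieceMap (k : ℕ) :
    EI (K := K) B i₀ (k + 1) →ₗ[MvPolynomial (Fin n) K]
      ((τ : PBT (B.restrict (· ≠ i₀)) (k + 1)) →
        MvPolynomial (Fin n) K ⧸ varIdeal K (pvars (B.restrict (· ≠ i₀)) τ.1)) :=
  (LinearEquiv.piCongrRight fun τ : PBT (B.restrict (· ≠ i₀)) (k + 1) =>
      Submodule.quotEquivOfEq _ _ (ptupleIdeal_eq_varIdeal (K := K) (B.restrict (· ≠ i₀)) τ.1)).toLinearMap ∘ₗ
    ((quotPieceEquiv (K := K) B i₀ ha₀ e k).toLinearMap ∘ₗ (subPiece (K := K) B i₀ ha₀ k).mkQ)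

/-- The quotient map is onto. -/
theorem quotPieceMap_surjective (k : ℕ) : Function.Surjective (quotPieceMap (K := K) B i₀ ha₀ e k) := by
  intro y
  obtain ⟨x, hx⟩ := Submodule.mkQ_surjective (subPiece (K := K) B i₀ ha₀ k)
    ((quotPieceEquiv (K := K) B i₀ ha₀ e k).symm
      ((LinearEquiv.piCongrRight fun τ : PBT (B.restrict (· ≠ i₀)) (k + 1) =>
        Submodule.quotEquivOfEq _ _ (ptupleIdeal_eq_varIdeal (K := K) (B.restrict (· ≠ i₀)) τ.1)).symm y))
  refine ⟨x, ?_⟩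
  simp only [quotPieceMap, LinearMap.comp_apply, hx, LinearEquiv.coe_toLinearMap, LinearEquiv.apply_symm_apply]

/-- Its kernel is the sub-piece. -/
theorem ker_quotPieceMap (k : ℕ) : LinearMap.ker (quotPieceMap (K := K) B i₀ ha₀ e k) = subPiece (K := K) B i₀ ha₀ k := by
  rw [quotPieceMap, LinearMap.ker_comp, LinearEquiv.ker, Submodule.comap_bot, LinearMap.ker_comp, LinearEquiv.ker,
    Submodule.comap_bot, Submodule.ker_mkQ]

/-- The kernel of the quotient map, as `Π_{(t, τ″)} R ⧸ varIdeal({t.a, t.b} ∪ vars τ″)`. -/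
noncomputable def kerQuotPieceMapEquiv (k : ℕ) :
    ↥(LinearMap.ker (quotPieceMap (K := K) B i₀ ha₀ e k)) ≃ₗ[MvPolynomial (Fin n) K]
      ((p : Br B i₀ × PBT (B.restrict (· ≠ i₀)) k) →
        MvPolynomial (Fin n) K ⧸ varIdeal K (optVars B (some p.1) ∪ pvars (B.restrict (· ≠ i₀)) p.2.1)) :=
  ((LinearEquiv.ofEq _ _ (ker_quotPieceMap (K := K) B i₀ ha₀ e k)).trans
    (subPieceEquiv (K := K) B i₀ ha₀ e k)).trans
    ((piProdSwapEquiv (A := MvPolynomial (Fin n) K)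
        (fun p : Br B i₀ × PBT (B.restrict (· ≠ i₀)) k =>
          MvPolynomial (Fin n) K ⧸
            (Ideal.span {(X p.1.1.2.2 : MvPolynomial (Fin n) K), X p.1.1.2.1} ⊔
              ptupleIdeal K (B.restrict (· ≠ i₀)) p.2.1))).symm.trans
      (LinearEquiv.piCongrRight fun p => Submodule.quotEquivOfEq _ _ (by
        rw [← optIdeal_some, optIdeal_eq_varIdeal, ptupleIdeal_eq_varIdeal, varIdeal_union])))

/-- The free pairs: a quotient piece `τ′` (on `k + 1` blocks of `M′`) against a sub piece `(t, τ″)` (`τ″` on `k`). -/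
theorem free_pairs (k : ℕ) (τ : PBT (B.restrict (· ≠ i₀)) (k + 1)) (p : Br B i₀ × PBT (B.restrict (· ≠ i₀)) k) :
    ∃ u ∈ pvars (B.restrict (· ≠ i₀)) τ.1, ∃ v ∈ pvars (B.restrict (· ≠ i₀)) τ.1, u ≠ v ∧
      u ∉ optVars B (some p.1) ∪ pvars (B.restrict (· ≠ i₀)) p.2.1 ∧
        v ∉ optVars B (some p.1) ∪ pvars (B.restrict (· ≠ i₀)) p.2.1 := by
  obtain ⟨u, hu, v, hv, huv, huS, hvS, hu'', hv''⟩ :=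
    exists_free_pair B i₀ τ.1 p.2.1 (by rw [τ.2, p.2.2]; exact Nat.lt_succ_self k)
  refine ⟨u, hu, v, hv, huv, ?_, ?_⟩
  · rw [Finset.mem_union, not_or]
    exact ⟨fun h => huS (optVars_subset B _ h), hu''⟩
  · rw [Finset.mem_union, not_or]
    exact ⟨fun h => hvS (optVars_subset B _ h), hv''⟩

/-- **Step (3): `Ext^{k+1}(I_M, I_M) ≃ₗ[R] (Π_{τ′ ∈ PBT(M′,k+1)} R ⧸ J_{τ′}) × (Π_{τ′ ∈ PBT(M′,k)} Π_{t} R ⧸ ((x_b,x_a) + J_{τ′}))`**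
— the extension of file XLI SPLITS (file XLII's `splitOfFreePairs` on the free pairs of file XLIII). -/
noncomputable def extSuccStepEquiv (k : ℕ) :
    EI (K := K) B i₀ (k + 1) ≃ₗ[MvPolynomial (Fin n) K]
      (((τ' : PBT (B.restrict (· ≠ i₀)) (k + 1)) → PQ (K := K) B i₀ (k + 1) τ') ×
        ((τ' : PBT (B.restrict (· ≠ i₀)) k) → (t : Br B i₀) →
          MvPolynomial (Fin n) K ⧸
            (Ideal.span {(X t.1.2.2 : MvPolynomial (Fin n) K), X t.1.2.1} ⊔
              ptupleIdeal K (B.restrict (· ≠ i₀)) τ'.1))) :=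
  (splitOfFreePairs (fun τ : PBT (B.restrict (· ≠ i₀)) (k + 1) => pvars (B.restrict (· ≠ i₀)) τ.1)
      (fun p : Br B i₀ × PBT (B.restrict (· ≠ i₀)) k => optVars B (some p.1) ∪ pvars (B.restrict (· ≠ i₀)) p.2.1)
      (quotPieceMap (K := K) B i₀ ha₀ e k) (quotPieceMap_surjective (K := K) B i₀ ha₀ e k)
      (kerQuotPieceMapEquiv (K := K) B i₀ ha₀ e k) (free_pairs B i₀ k)).trans
    ((LinearEquiv.prodComm (MvPolynomial (Fin n) K) _ _).trans
      (LinearEquiv.prodCongr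
        (LinearEquiv.piCongrRight fun τ : PBT (B.restrict (· ≠ i₀)) (k + 1) =>
          (Submodule.quotEquivOfEq _ _ (ptupleIdeal_eq_varIdeal (K := K) (B.restrict (· ≠ i₀)) τ.1)).symm)
        ((LinearEquiv.ofEq _ _ (ker_quotPieceMap (K := K) B i₀ ha₀ e k)).trans
          (subPieceEquiv (K := K) B i₀ ha₀ e k))))

end Step

/-! ## The induction on the number of blocks -/

/-- **Base**: with NO blocks `I_M = R`: `Ext⁰_R(R, R) = R = R ⧸ J_{()}` (the empty tuple), `Ext^{k+1}_R(R, R) = 0` (no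
partial tuple of positive degree). -/
noncomputable def extEquivOfIsEmpty {ι : Type} [Fintype ι] [IsEmpty ι] (B : Blocks ι n) : (q : ℕ) →
    Ext.{u} (ModuleCat.of (MvPolynomial (Fin n) K) ↥(arrIdeal K B))
        (ModuleCat.of (MvPolynomial (Fin n) K) ↥(arrIdeal K B)) q
      ≃ₗ[MvPolynomial (Fin n) K] ((τ : PBT B q) → MvPolynomial (Fin n) K ⧸ ptupleIdeal K B τ.1)
  | 0 =>
    ((extCongrOfEq (arrIdeal_eq_top_of_isEmpty (K := K) B) 0).trans
      (extZeroTopEquiv (A := MvPolynomial (Fin n) K))).trans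
      ((Submodule.quotEquivOfEq _ _ (ptupleIdeal_of_isEmpty (K := K) B (default : PBT B 0).1).symm).trans
        (piUniqueEquiv (A := MvPolynomial (Fin n) K)
          (fun τ : PBT B 0 => MvPolynomial (Fin n) K ⧸ ptupleIdeal K B τ.1)).symm)
  | k + 1 =>
    haveI : Module.Projective (MvPolynomial (Fin n) K) ↥(⊤ : Ideal (MvPolynomial (Fin n) K)) :=
      Module.Projective.of_equiv (Submodule.topEquiv.symm :
        MvPolynomial (Fin n) K ≃ₗ[MvPolynomial (Fin n) K] ↥(⊤ : Ideal (MvPolynomial (Fin n) K)))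
    haveI : Subsingleton (Ext.{u} (ModuleCat.of (MvPolynomial (Fin n) K) ↥(⊤ : Ideal (MvPolynomial (Fin n) K)))
        (ModuleCat.of (MvPolynomial (Fin n) K) ↥(⊤ : Ideal (MvPolynomial (Fin n) K))) (k + 1)) :=
      subsingleton_of_forall_eq 0 fun e => Ext.eq_zero_of_projective e
    (extCongrOfEq (arrIdeal_eq_top_of_isEmpty (K := K) B) (k + 1)).trans (LinearEquiv.ofSubsingleton _ _)

/-- **The induction**: for every block model with `r` blocks and EVERY degree `q`,
`Ext^q_R(I_M, I_M) ≃ₗ[R] Π_{τ ∈ PBT(M, q)} R ⧸ J_τ`. -/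
theorem nonempty_extEquiv_of_card (r : ℕ) :
    ∀ {ι : Type} [Fintype ι] [DecidableEq ι] (B : Blocks ι n), Fintype.card ι = r → ∀ q : ℕ,
      Nonempty (Ext.{u} (ModuleCat.of (MvPolynomial (Fin n) K) ↥(arrIdeal K B))
          (ModuleCat.of (MvPolynomial (Fin n) K) ↥(arrIdeal K B)) q
        ≃ₗ[MvPolynomial (Fin n) K] ((τ : PBT B q) → MvPolynomial (Fin n) K ⧸ ptupleIdeal K B τ.1)) := by
  induction r with
  | zero =>
    intro ι _ _ B hr q
    haveI : IsEmpty ι := Fintype.card_eq_zero_iff.1 hr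
    exact ⟨extEquivOfIsEmpty (K := K) B q⟩
  | succ r ih =>
    intro ι _ _ B hr q
    obtain ⟨i₀⟩ : Nonempty ι := Fintype.card_pos_iff.1 (by omega)
    have hcard : Fintype.card {i // i ≠ i₀} = r := by
      rw [Fintype.card_subtype, Finset.filter_ne', Finset.card_erase_of_mem (Finset.mem_univ _),
        Finset.card_univ, hr]
      rfl
    obtain ⟨a₀, ha₀⟩ := B.nonempty i₀
    have e : ∀ q : ℕ, EPrimeK (K := K) B i₀ q ≃ₗ[MvPolynomial (Fin n) K]
        ((τ : PBT (B.restrict (· ≠ i₀)) q) → PQ (K := K) B i₀ q τ) :=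
      fun q => Classical.choice (ih (B.restrict (· ≠ i₀)) hcard q)
    cases q with
    | zero =>
      exact ⟨((extCongrOfEq (arrIdeal_eq_blockIdeal_inf_restrict (K := K) B i₀) 0).trans
        (extZeroStepEquiv (K := K) B i₀ ha₀ e)).trans (pbtQuotPiZeroEquiv (K := K) B i₀).symm⟩
    | succ k =>
      exact ⟨((extCongrOfEq (arrIdeal_eq_blockIdeal_inf_restrict (K := K) B i₀) (k + 1)).trans
        (extSuccStepEquiv (K := K) B i₀ ha₀ e k)).trans (pbtQuotPiSuccEquiv (K := K) B i₀ k).symm⟩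

section Main

variable {ι : Type} [Fintype ι] [DecidableEq ι] (B : Blocks ι n)

/-- **EXT-NOTE §6.B(c) IN EVERY DEGREE AT EVERY CROSSING GERM, over any commutative ring**:
`Ext^q_R(I_M, I_M) ≃ₗ[R] Π_{τ ∈ PBT(M, q)} R ⧸ J_τ` over the partial branch tuples `τ` of the block model `M` on exactly
`q` blocks, `J_τ = Σ_{i used} (x_{b_i}, x_{a_i})` — «`𝓔xt^q(I_Z, I_Z)` at a point through which `r` translates pass is
carried by the `q`-fold intersections `⋂_{i ∈ J} B_i` of one component `B_i ⊂ W + t_i` for each translate of a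
`q`-element set `J` of translates through the point, each exactly once, and nothing else».  Every `q`, `r`, `n`, `K`.
(The equivalence is CHOSEN (`Classical.choice`) from the inductive construction `nonempty_extEquiv_of_card`; the
explicit one-step equivalences are `extZeroStepEquiv` ∕ `extSuccStepEquiv`.) -/
noncomputable def extEquiv (q : ℕ) :
    Ext.{u} (ModuleCat.of (MvPolynomial (Fin n) K) ↥(arrIdeal K B))
        (ModuleCat.of (MvPolynomial (Fin n) K) ↥(arrIdeal K B)) q
      ≃ₗ[MvPolynomial (Fin n) K] ((τ : PBT B q) → MvPolynomial (Fin n) K ⧸ ptupleIdeal K B τ.1) :=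
  Classical.choice (nonempty_extEquiv_of_card (K := K) _ B rfl q)

end Main

/-! ### At a point of a (GEN) arrangement -/

/-- **EXT-NOTE §6.B(c), every degree, at a point `q₀` of a (GEN) arrangement `Z_T`** (file XXIV's block structure
`Blocks.ofPoint q₀ T`, blocks = the coincidence sets `S_t(q₀)` of the translates through `q₀`): `Ext^q` of the local
ideal with itself is `Π_{τ} R ⧸ J_τ` over the choices `τ` of `q` translates through `q₀` and one branch
`(a_t, b_t) ⊂ S_t(q₀)` for each (the étale-local identification itself stays prose). -/
noncomputable def extEquiv_ofPoint {G : Type} [DecidableEq G] (q₀ : Fin n → G) (T : Finset (Fin n → G))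
    (hGEN : ∀ t ∈ T, ∀ t' ∈ T, t ≠ t' → ∀ k, t k ≠ t' k) (q : ℕ) :
    Ext.{u} (ModuleCat.of (MvPolynomial (Fin n) K) ↥(arrIdeal K (Blocks.ofPoint q₀ T hGEN)))
        (ModuleCat.of (MvPolynomial (Fin n) K) ↥(arrIdeal K (Blocks.ofPoint q₀ T hGEN))) q
      ≃ₗ[MvPolynomial (Fin n) K]
        ((τ : PBT (Blocks.ofPoint q₀ T hGEN) q) →
          MvPolynomial (Fin n) K ⧸ ptupleIdeal K (Blocks.ofPoint q₀ T hGEN) τ.1) :=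
  extEquiv (K := K) (Blocks.ofPoint q₀ T hGEN) q

end Summit.Ventures.HSemireg.ObstructionLocus.BlockModel
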